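import Summits.BirchSwinnertonDyer.BirchSwinnertonDyer.Theorems.ManinLocalTwoThreeBracketSturmEightyEight
import Summits.BirchSwinnertonDyer.BirchSwinnertonDyer.Theorems.ManinLocalTwoThreeExistsMinimalOptimalDatum
import Literature.NumberTheory.EllipticCurves.Gamma0RankinSelbergPairing
import HarnessLib

/-!
# Level 88: `|c| = 1` — hence `2 ∤ c` — for EVERY lattice-optimal `X₀(88)`-datum of EVERY globally minimal elliptic curve over `ℚ`, UNCONDITIONALLY
# (C2 domain, `8 ∣ 88`, genus 9, ONE class `88a`; the newform pinned by an g54's PINNING KERNEL, the `c`-side by this seat's light Bracket–Sturm certificate)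

Cell bsd-f2-manin, route `ManinLocalTwoThree` (crux C2 `ManinOddAtFour`, stmt-22967: `2² ∣ 88`), prover seat p2 gen 30; `--supports` (helper).
ASSEMBLY of the level-`88` programme: an g54's `PinningEightyEight.pinning_eightyEight` (`176 • D.f = Σ_j y88a_j • C_j` on the `σ`-closed holomorphic
`η`-basis `C₀..C₁₅` of `M₂(Γ₀(88))`, staged box sieve + Fricke sieve, fact-free) is BRIDGED by dual separation (`PinningKernel.eq_of_dual`: two forms of
`M₂(Γ₀(88))` with the same coefficients on the support of the sixteen integer dual vectors are equal; the comparison `176·aₙ(−4Q2 + Q3) = Σ_j y88a_j·tabs_j[n]`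
there is ONE `decide`) to the LIGHT expression **`⇑D.f = −4·Q2 + Q3`** (`Q2 = η₄³η₄₄³/(η₂η₂₂)`, `Q3 = η₂³η₂₂³/(η₄η₄₄)`), and the Bracket–Sturm certificate
`…BracketSturmEightyEight.abs_maninConstant_eq_one_eightyEight_of_pinned` gives **`|c| = 1` and `2 ∤ c` on `X₀(88)`**; the domain is inhabited under the
item's binder `exists_isNewformOf` (`N(88a1) = 88` by kernel Tate certificate).  HONEST FRAMING: unconditional (standard axioms); one level of C2 — nothing
here proves C2 for all `N`, Manin's conjecture or BSD. [cite: AtkinLehner1970, Thm. 3] [cite: Manin1972, Prop. 1.4] [cite: Sturm1987, Thm. 1]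
[cite: AgasheRibetStein2006, §§1–2] [cite: CremonaAlgorithms1997, §2.10, Table 1 (88a1), Table 3 (N = 88)] [cite: EdixhovenManin1991, Prop. 2]
-/

set_option autoImplicit false
-- lint-debt: the directory name repeats the summit name (sibling precedent `ManinLocalTwoThreeBracketSturmEighty.lean`)
set_option linter.dupNamespace false

noncomputable section

open Complex Filter Topology Set Function
open UpperHalfPlane hiding I
open scoped Real Topology MatrixGroups ModularForm
open ModularForm CongruenceSubgroup PowerSeries
open Literature.NumberTheory.ModularForms
open Literature.NumberTheory.EllipticCurves Literature.NumberTheory.EllipticCurves.ModularForms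
open Literature.NumberTheory.Automorphic

namespace Summit.BirchSwinnertonDyer.BirchSwinnertonDyer.Theorems.ManinLocalTwoThree.LevelEightyEight

open BracketSturm PinningKernel PinningEightyEight

variable {W : WeierstrassCurve ℚ} [W.IsElliptic]

/-! ## §1 The bridge: from the pinning on `C₀..C₁₅` to the light expression `−4Q2 + Q3` -/

/-- The dual-support comparison `176·aₙ(88a1) = Σ_j y88a_j·tabs_j[n]` at every `n` in the support of the sixteen dual vectors (kernel check). [folklore] -/
theorem bridge_check_eightyEight : ∀ i : Fin 16, ∀ n < (duals i).length, (duals i).getD n 0 ≠ 0 →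
    176 * ([0, 1, 0, -3, 0, -3, 0, -2, 0, 6, 0, -1, 0, 0, 0, 9, 0, -6, 0, 4, 0, 6, 0, 1, 0, 4, 0, -9, 0, -8, 0, -7, 0, 3, 0, 6, 0, -1, 0, 0, 0, 4, 0, 6, 0, -18, 0, -8, 0, -3, 0, 18, 0, 2, 0, 3, 0, -12, 0, -1, 0, 4, 0, -12, 0, 0, 0, -5, 0, -3, 0, 3, 0, 16, 0, -12, 0, 2, 0, 2, 0, 9, 0, -2, 0, 18, 0, 24, 0, 15, 0, 0, 0, 21, 0, -12, 0, -7, 0, -6, 0, -10, 0, -16, 0, -18, 0, 2, 0, -14, 0, 3, 0, -7, 0, -3, 0, 0, 0, 12, 0, 1, 0, -12, 0, 3, 0, 4, 0, -18, 0, -2, 0, -8, 0, 27, 0, -15, 0, -22, 0, 24, 0, 0, 0] : List ℤ).getD n 0 = ∑ j : Fin 16, y88a.getD (j : ℕ) 0 * (tabs j).getD n 0 := by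
  decide +kernel

/-- **THE NEWFORM OF EVERY `X₀(88)`-DATUM, AS A FUNCTION: `⇑D.f = −4·Q2 + Q3`** (`Q2 = η₄³η₄₄³/(η₂η₂₂)`, `Q3 = η₂³η₂₂³/(η₄η₄₄)`) — FACT-FREE: an g54's pinning
`176 • D.f = Σ y88a_j • C_j`, then dual separation against the light combination. [cite: AtkinLehner1970, Thm. 3] [cite: CremonaAlgorithms1997, Table 3 (N = 88)] -/
theorem f_apply_eq_eightyEight (D : ModularParametrizationData W 88) :
    ⇑D.f = (fun τ ↦ -4 * etaQuotient 88 (expFn [(2, -1), (4, 3), (22, -1), (44, 3)]) τ + etaQuotient 88 (expFn [(2, 3), (4, -1), (22, 3), (44, -1)]) τ) := by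
  haveI : FiniteDimensional ℂ (ModularForm (Gamma0 88) 2) := Module.finite_of_finrank_eq_succ finrank_modularForm_two_88
  obtain ⟨C, hC, -, hpin⟩ := pinning_eightyEight D
  have ht := tables_of_etaCerts 88 48 (fun i : Fin 16 ↦ expFn (Ls[(i : ℕ)]).1) (fun i ↦ shifts i) tabs C hC hshift hcert
  obtain ⟨F, hFt, hFcoe⟩ := exists_formF_eightyEight
  have h176 : ((176 : ℤ) : ℂ) • F = ∑ j : Fin 16, ((y88a.getD (j : ℕ) 0 : ℤ) : ℂ) • C j := by
    refine eq_of_dual C tabs duals 1413632 ht hlen hdual (by norm_num) finrank_modularForm_two_88 fun i n hn h0 ↦ ?_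
    have hn48 : n < 48 := lt_of_lt_of_le hn (hlen i)
    rw [map_smul, smul_eq_mul, modCoefₗ_apply, ← hFt n (by omega), map_sum]
    rw [Finset.sum_congr rfl fun j _ ↦ by rw [map_smul, smul_eq_mul, ← ht j n hn48]]
    exact_mod_cast congrArg (fun z : ℤ ↦ (z : ℂ)) (bridge_check_eightyEight i n hn h0)
  have hF : F = ModularFormClass.modularForm D.f :=
    smul_right_injective (ModularForm (Gamma0 88) 2) (show ((176 : ℤ) : ℂ) ≠ 0 by norm_num) (h176.trans hpin.symm)
  have hcoe : (⇑(ModularFormClass.modularForm D.f) : ℍ → ℂ) = ⇑D.f := rfl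
  rw [← hcoe, ← hF, hFcoe]

/-! ## §2 The headline: `|c| = 1`, `2 ∤ c` on `X₀(88)`, unconditionally -/

/-- **`|c| = 1` for every lattice-optimal `X₀(88)`-datum of every globally minimal elliptic `W/ℚ`** — UNCONDITIONAL (pinning kernel + dual bridge + the
class's Bracket–Sturm certificate with the Néron lattice of `88a1`). [cite: Manin1972, Prop. 1.4] [cite: AgasheRibetStein2006, §§1–2]
[cite: CremonaAlgorithms1997, §2.10, Table 1 (88a1)] -/
theorem abs_maninConstant_eq_one_eightyEight (W : WeierstrassCurve ℚ) [W.IsElliptic] [W.IsGloballyMinimal]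
    (D : ModularParametrizationData W 88) (hopt : ∀ z ∈ D.L.lattice, ∃ w ∈ periodLattice D.f, z = D.c * w) :
    |D.maninConstant| = 1 :=
  abs_maninConstant_eq_one_eightyEight_of_pinned W D hopt (f_apply_eq_eightyEight D)

/-- **C2 `ManinOddAtFour` at `N = 88` (`2² ∣ 88`): `2 ∤ c(D)`** for every lattice-optimal `X₀(88)`-datum — UNCONDITIONAL. [cite: AgasheRibetStein2006, §§1–2] -/
theorem not_two_dvd_maninConstant_eightyEight (W : WeierstrassCurve ℚ) [W.IsElliptic] [W.IsGloballyMinimal]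
    (D : ModularParametrizationData W 88) (hopt : ∀ z ∈ D.L.lattice, ∃ w ∈ periodLattice D.f, z = D.c * w) :
    ¬ (2 : ℤ) ∣ D.maninConstant :=
  not_two_dvd_maninConstant_eightyEight_of_pinned W D hopt (f_apply_eq_eightyEight D)

/-- **No prime divides `c` on `X₀(88)`.** [cite: AgasheRibetStein2006, §§1–2] -/
theorem not_prime_dvd_maninConstant_eightyEight (W : WeierstrassCurve ℚ) [W.IsElliptic] [W.IsGloballyMinimal]
    (D : ModularParametrizationData W 88) (hopt : ∀ z ∈ D.L.lattice, ∃ w ∈ periodLattice D.f, z = D.c * w)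
    {p : ℕ} (hp : p.Prime) : ¬ (p : ℤ) ∣ D.maninConstant := by
  have h := abs_maninConstant_eq_one_eightyEight W D hopt
  intro hpd
  have h1 := Int.le_of_dvd (by rw [h]; norm_num) ((dvd_abs _ _).mpr hpd)
  rw [h] at h1
  have := hp.two_le
  omega

/-- **The C2 conclusion on the whole `X₀(88)`-domain**: `2² ∣ 88`, and `|c| = 1 ∧ 2 ∤ c` for every lattice-optimal `X₀(88)`-datum of every globally minimal
elliptic curve over `ℚ` — UNCONDITIONAL; BSD and C2 for general `N` are NOT proved by this. [folklore] -/
theorem maninOddAtFour_eightyEight :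
    2 ^ 2 ∣ 88 ∧ ∀ (W : WeierstrassCurve ℚ) [W.IsElliptic] [W.IsGloballyMinimal] (D : ModularParametrizationData W 88),
      (∀ z ∈ D.L.lattice, ∃ w ∈ periodLattice D.f, z = D.c * w) → |D.maninConstant| = 1 ∧ ¬ (2 : ℤ) ∣ D.maninConstant :=
  ⟨⟨22, by norm_num⟩, fun W _ _ D hopt ↦ ⟨abs_maninConstant_eq_one_eightyEight W D hopt, not_two_dvd_maninConstant_eightyEight W D hopt⟩⟩

/-! ## §3 The domain is inhabited under the item's binder `exists_isNewformOf` -/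

/-- **Modularity at `88a1`, levelled**: under `exists_isNewformOf` the curve `[0, 0, 0, −4, 4]` has a newform in `S₂(Γ₀(88))` (`conductorNorm_eightyEightA1`).
CONDITIONAL on the item's own binder. [cite: DiamondShurman2005, Thm. 8.8.3] -/
theorem exists_isNewformOf_eightyEightA1 (hnf : exists_isNewformOf) :
    ∃ f : CuspForm (Gamma0 88) 2, IsNewformOf (⟨0, 0, 0, -4, 4⟩ : WeierstrassCurve ℚ) f := by
  haveI := isElliptic_eightyEightA1
  have key : ∀ (N : ℕ) [NeZero N], (⟨0, 0, 0, -4, 4⟩ : WeierstrassCurve ℚ).conductorNorm ℤ = N →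
      ∃ f : CuspForm (Gamma0 N) 2, IsNewformOf (⟨0, 0, 0, -4, 4⟩ : WeierstrassCurve ℚ) f := by
    intro N _ hN
    subst hN
    exact hnf _
  haveI : NeZero (88 : ℕ) := ⟨by decide⟩
  exact key 88 conductorNorm_eightyEightA1

/-- **A lattice-optimal `X₀(88)`-datum on a globally minimal model in the class `88a` exists under modularity**, with `|c| = 1` and `2 ∤ c`; CONDITIONAL on
`exists_isNewformOf` only. [cite: EdixhovenManin1991, Prop. 2] -/
theorem domain_inhabited_eightyEight_of_modularity (hnf : exists_isNewformOf) :
    ∃ (W₀ : WeierstrassCurve ℚ) (_ : W₀.IsElliptic) (_ : W₀.IsGloballyMinimal) (D₀ : ModularParametrizationData W₀ 88),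
      (⟨0, 0, 0, -4, 4⟩ : WeierstrassCurve ℚ).IsIsogenous W₀ ∧ (∀ z ∈ D₀.L.lattice, ∃ w ∈ periodLattice D₀.f, z = D₀.c * w) ∧
      |D₀.maninConstant| = 1 ∧ ¬ (2 : ℤ) ∣ D₀.maninConstant := by
  haveI := isElliptic_eightyEightA1
  haveI : NeZero (88 : ℕ) := ⟨by decide⟩
  obtain ⟨f, hf⟩ := exists_isNewformOf_eightyEightA1 hnf
  obtain ⟨D⟩ := nonempty_modularParametrizationData_of_isNewformOf hf
  obtain ⟨W₀, h₀, hmin, D₀, -, hiso, hopt, -⟩ :=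
    ExistsMinimalOptimalDatum.existsMinimalOptimalDatum_full (⟨0, 0, 0, -4, 4⟩ : WeierstrassCurve ℚ) D
  exact ⟨W₀, h₀, hmin, D₀, hiso, hopt, @abs_maninConstant_eq_one_eightyEight W₀ h₀ hmin D₀ hopt,
    @not_two_dvd_maninConstant_eightyEight W₀ h₀ hmin D₀ hopt⟩

end Summit.BirchSwinnertonDyer.BirchSwinnertonDyer.Theorems.ManinLocalTwoThree.LevelEightyEight

end
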